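import Summits.BirchSwinnertonDyer.BirchSwinnertonDyer.Theorems.ResidualThetaTransportAtTwoSignedMuVanishingAtTwoPlusCuspSpanHecke
import Summits.BirchSwinnertonDyer.BirchSwinnertonDyer.Theorems.ResidualThetaTransportAtTwoSignedMuVanishingAtTwoPlusFlatSymbols
import Summits.BirchSwinnertonDyer.BirchSwinnertonDyer.Theorems.ResidualThetaTransportAtTwoSignedMuVanishingAtTwoPlusAnalyticChild
import Summits.BirchSwinnertonDyer.BirchSwinnertonDyer.Theorems.ResidualThetaTransportAtTwoThetaLayerLambdaCongruenceAtTwoDepletion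
import Literature.NumberTheory.EllipticCurves.PAdicLFunctionIntegralityAtTwoQuarterProofs
import Literature.NumberTheory.EllipticCurves.PAdicLFunctionDistributionHoldsProofs
import Summits.BirchSwinnertonDyer.BirchSwinnertonDyer.Theorems.EisensteinDepletionAtTwoStarGlueFinScaleLemmas
import HarnessLib

/-!
# Route `ResidualThetaTransportAtTwo`, crux Kμ⁺ `SignedMuVanishingAtTwoPlus` (stmt-BirchSwinnertonDyer-20689),
# line `birth`, stub `stub_flatMuZeroAtTwo`: THEOREM (R) assembled — the curve-free spanning hypothesis
# (G′)_{N_W} implies FLAT at `(W, f)`; (G′)_N for every odd `N` implies the registered stub `FlatMuZeroAtTwo`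

Cell `bsd-wall`, lead `bsd-wall-rtt-p4` g5 (helper; THEOREMS ONLY — no `def`, no named fact, no `sorry`; (G′)_N is a
HYPOTHESIS everywhere, spelled inline as in `…CuspSpanHecke`; BSD is not proved by this). Sequel of
`…CuspSpanHeckeShimura` (step (d)) and `…CuspSpanHecke` (steps (c)(e): `exists_odd_re_cuspSymbol_of_cuspSpan`), closing
lead g4's Theorem (R) (`Cruxes/SignedMuVanishingAtTwoPlus/FlatCuspSpan.md` §2) with steps (a)(b), which the tree
already holds in substance (`exists_three_mul_ratPlusSymbol_zero_eq_intCast`: `3[0]⁺_f ∈ ℤ` at `a₂ = 0`, odd level —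
the parity identity (a); Manin's `{∞, γ0} = {∞, γ∞} + {∞, 0}`, `modularSymbol_gamma0_smul_holds` — step (b)):

* §1 `ratPlusSymbol_apply_div_eq_add_half` — for `γ = (a b; c d) ∈ Γ₀(N)` and a rational newform `f`:
  `[b/d]⁺_f = [0]⁺_f + m_γ/2` with `m_γ = 2 re{∞, γ∞}_f / Ω⁺_f ∈ ℤ` (the SAME integer as in `…CuspSpanHecke`);
  `norm_ratPlusSymbol_eq_two_of_odd` — at `a₂ = 0`, odd level: `m_γ` odd ⟹ `|[b/d]⁺_f|₂ = 2` (`6[b/d]⁺ = 2k + 3m_γ` odd).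
* §2 `exists_ratPlusSymbol_pow_cyclotomicGenerator_eq` — relocation: for `|d| = 4^k = 2^{n+2}` (`b` odd),
  `[b/d]⁺_f = [5^s/2^{n+2}]⁺_f` for some `s mod 2ⁿ` (`±5^s` exhaust the odd residues, the sibling seat's
  `exists_sign_mul_cyclotomicGenerator_pow_eq`; `[−r]⁺ = [r]⁺`, `[r+1]⁺ = [r]⁺`).
* §3 `exists_two_le_norm_ratPlusSymbol_of_cuspSpan` (one rational newform, `a₂ = 0`, odd level, (G′)_N) ⟹ some
  `[5^s/2^{n+2}]⁺_f`, `n` even, has `|·|₂ ≥ 2`; `flatAtTwo_of_cuspSpan` (habitat⁺: `IsNewformOf W f`, `GoodSS W 2`,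
  `a₂(W) = 0`): **(G′)_{N_W} ⟹ `2 ∤ L♭` for every Pollack pair of `f` at `2`** (door p578368/FlatSymbols
  `flatAtTwo_of_two_le_norm_ratPlusSymbol`); `flatMuZeroAtTwo_of_cuspSpan`: (G′)_N for every odd `N` ⟹ the registered
  stub statement `FlatMuZeroAtTwo` (spelled verbatim); `signedMuAnalyticAtTwoPlus_of_abbesUllmo_of_cuspSpan`: with
  Abbes–Ullmo Thm A by name, the analytic child 21437 `SignedMuAnalyticAtTwoPlus`.

So the research content of the analytic stub is reduced, in the kernel, to ONE curve-free, `f`-free, finite-per-level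
statement about `X₀(N)` — verified by exact linear algebra for all odd `N ≤ 2999` with `g ≥ 1` and the five smallest
habitat⁺ conductors (memo §4; kit j295333 for all 147), OPEN for infinite families.

References: B. Mazur, J. Tate, J. Teitelbaum, Invent. Math. 84 (1986) §I.4 (4.2), §I.8, §I.13
[MazurTateTeitelbaum1986Invent]; J. E. Cremona, *Algorithms for modular elliptic curves* (1997) §2.1, §2.8
[CremonaAlgorithms1997]; R. Pollack, Duke Math. J. 118 (2003) Conj. 6.3, Prop. 6.18 [Pollack2003]; A. Abbes, E. Ullmo,
Compositio 103 (1996) Thm. A [AbbesUllmo1996].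
-/

set_option autoImplicit false
set_option linter.dupNamespace false

noncomputable section

open scoped Classical MatrixGroups ModularForm

open CongruenceSubgroup WeierstrassCurve Literature.NumberTheory.EllipticCurves
  Literature.NumberTheory.EllipticCurves.ModularForms Literature.NumberTheory.EllipticCurves.Rank1Residual
  Literature.NumberTheory.IwasawaTheory Summit.BirchSwinnertonDyer.Rank1Residual.Supersingular
  Summit.BirchSwinnertonDyer.BirchSwinnertonDyer.Theses.ResidualThetaTransportAtTwo

namespace Summit.BirchSwinnertonDyer.BirchSwinnertonDyer.Theorems.SignedMuAtTwo

/-! ## §1. `[b/d]⁺_f = [0]⁺_f + m_γ/2` and the `2`-adic norm when `m_γ` is odd -/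

section OneForm

variable {N : ℕ} [NeZero N] (f : CuspForm (Gamma0 N) 2)

/-- **Manin at the cusp `0`, with the integer identified**: for `γ = (a b; c d) ∈ Γ₀(N)` (`d ≠ 0`), real coefficients
and `Ω⁺_f ≠ 0`: `[b/d]⁺_f = [0]⁺_f + m_γ/2` as REAL numbers (`normalizedPlusSymbol`), where `m_γ ∈ ℤ` is the doubled
plus period `2 re{∞, γ∞}_f/Ω⁺_f` (`{∞, γ0} = {∞, γ∞} + {∞, 0}`, `modularSymbol_gamma0_smul_holds`; `[x]⁺ = re{∞,x}/Ω⁺`).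
[cite: Manin1972, Prop. 1.4 and Thm. 1.6] [cite: CremonaAlgorithms1997, §2.8] -/
theorem normalizedPlusSymbol_apply_div_eq_add_half (hreal : ∀ n, (cuspCoeff f n).im = 0) (hΩ : plusPeriod f ≠ 0)
    (γ : Gamma0 N) (hd : (γ : SL(2, ℤ)) 1 1 ≠ 0) {m : ℤ} (hm : (cuspSymbol f γ).re = m * (plusPeriod f / 2)) :
    normalizedPlusSymbol f ((((γ : SL(2, ℤ)) 0 1 : ℤ) : ℚ) / (((γ : SL(2, ℤ)) 1 1 : ℤ) : ℚ)) =
      normalizedPlusSymbol f 0 + (m : ℝ) / 2 := by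
  have hr : ((γ : SL(2, ℤ)) 1 0 : ℚ) * 0 + ((γ : SL(2, ℤ)) 1 1 : ℚ) ≠ 0 := by
    rw [mul_zero, zero_add]; exact_mod_cast hd
  have h := modularSymbol_gamma0_smul_holds f γ 0 hr
  simp only [mul_zero, zero_add] at h
  rw [normalizedPlusSymbol, normalizedPlusSymbol, plusSymbol_eq_re_holds f hreal, plusSymbol_eq_re_holds f hreal,
    Complex.ofReal_re, Complex.ofReal_re, h, Complex.add_re, hm]
  field_simp
  ring

/-- **`[b/d]⁺_f = [0]⁺_f + m_γ/2` in `ℚ`** for a normalised newform with rational coefficients (`ratPlusSymbol`,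
`ratCast_ratPlusSymbol_holds`). [cite: MazurTateTeitelbaum1986Invent, §I.8] -/
theorem ratPlusSymbol_apply_div_eq_add_half (hf : IsNewform0 f) (hQ : coeffField f = ⊥) (γ : Gamma0 N)
    (hd : (γ : SL(2, ℤ)) 1 1 ≠ 0) {m : ℤ} (hm : (cuspSymbol f γ).re = m * (plusPeriod f / 2)) :
    ratPlusSymbol f ((((γ : SL(2, ℤ)) 0 1 : ℤ) : ℚ) / (((γ : SL(2, ℤ)) 1 1 : ℤ) : ℚ)) =
      ratPlusSymbol f 0 + (m : ℚ) / 2 := by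
  have hreal : ∀ n, (cuspCoeff f n).im = 0 := cuspCoeff_im_eq_zero_of_coeffField_eq_bot hQ
  have hΩ : plusPeriod f ≠ 0 := (IsNewform0.plusPeriod_pos_holds hf hQ).ne'
  apply Rat.cast_injective (α := ℝ)
  push_cast
  rw [ratCast_ratPlusSymbol_holds hf hQ, ratCast_ratPlusSymbol_holds hf hQ,
    normalizedPlusSymbol_apply_div_eq_add_half f hreal hΩ γ hd hm]

/-- **Odd doubled plus period ⟹ half-integral plus symbol at `2`.** For a normalised newform `f` of ODD level with
rational coefficients and `a₂(f) = 0`, and `γ = (a b; c d) ∈ Γ₀(N)`, `d ≠ 0`, with `m_γ = 2 re{∞, γ∞}_f/Ω⁺_f` ODD: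
`|[b/d]⁺_f|₂ = 2` (`3[0]⁺ = k ∈ ℤ` by the parity identity `exists_three_mul_ratPlusSymbol_zero_eq_intCast`, so
`6[b/d]⁺ = 2k + 3m_γ` is odd). [cite: MazurTateTeitelbaum1986Invent, §I.4 (4.2) and §I.8] -/
theorem norm_ratPlusSymbol_eq_two_of_odd (hf : IsNewform0 f) (hQ : coeffField f = ⊥) (h2N : ¬ 2 ∣ N)
    (ha₂ : cuspCoeff f 2 = 0) (γ : Gamma0 N) (hd : (γ : SL(2, ℤ)) 1 1 ≠ 0) {m : ℤ} (hmo : Odd m)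
    (hm : (cuspSymbol f γ).re = m * (plusPeriod f / 2)) :
    ‖((ratPlusSymbol f ((((γ : SL(2, ℤ)) 0 1 : ℤ) : ℚ) / (((γ : SL(2, ℤ)) 1 1 : ℤ) : ℚ)) : ℚ) : ℚ_[2])‖ = 2 := by
  have hreal : ∀ n, (cuspCoeff f n).im = 0 := cuspCoeff_im_eq_zero_of_coeffField_eq_bot hQ
  obtain ⟨k, hk⟩ := exists_three_mul_ratPlusSymbol_zero_eq_intCast hf hreal h2N ha₂
  have h6 : ratPlusSymbol f ((((γ : SL(2, ℤ)) 0 1 : ℤ) : ℚ) / (((γ : SL(2, ℤ)) 1 1 : ℤ) : ℚ)) =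
      ((2 * k + 3 * m : ℤ) : ℚ) / 6 := by
    rw [ratPlusSymbol_apply_div_eq_add_half f hf hQ γ hd hm]
    push_cast
    linarith
  have hodd : Odd (2 * k + 3 * m) := by
    obtain ⟨t, rfl⟩ := hmo
    exact ⟨k + 3 * t + 1, by ring⟩
  rw [h6]
  push_cast
  rw [norm_div, show ((2 : ℚ_[2]) * k + 3 * m) = ((2 * k + 3 * m : ℤ) : ℚ_[2]) by push_cast; ring,
    DepletionAtTwo.norm_intCast_eq_one_of_odd hodd,
    show (6 : ℚ_[2]) = ((2 : ℤ) : ℚ_[2]) * ((3 : ℤ) : ℚ_[2]) by norm_num, norm_mul,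
    DepletionAtTwo.norm_intCast_eq_one_of_odd (by decide : Odd (3 : ℤ)), mul_one]
  have h2 : ‖((2 : ℤ) : ℚ_[2])‖ = (2 : ℝ)⁻¹ := by
    have := Padic.norm_p (p := 2)
    exact_mod_cast this
  rw [h2, one_div, inv_inv]

end OneForm

/-! ## §2. Relocation: `[b/d]⁺ = [5^s/2^{n+2}]⁺` for `|d| = 2^{n+2}` -/

section Relocation

variable {N : ℕ} [NeZero N] (f : CuspForm (Gamma0 N) 2)

/-- `[u.val/D]⁺ = [b/D]⁺` when `u = b` in `ZMod D` (`[r + t]⁺ = [r]⁺`, `t ∈ ℤ`). [folklore] -/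
theorem ratPlusSymbol_val_div_eq_of_eq_intCast {D : ℕ} [NeZero D] {u : ZMod D} {b : ℤ} (hu : u = (b : ZMod D)) :
    ratPlusSymbol f ((u.val : ℚ) / D) = ratPlusSymbol f ((b : ℚ) / D) := by
  have hdvd : (D : ℤ) ∣ (u.val : ℤ) - b := by
    rw [← ZMod.intCast_zmod_eq_zero_iff_dvd]
    push_cast
    rw [ZMod.natCast_zmod_val, hu, sub_self]
  obtain ⟨t, ht⟩ := hdvd
  have hD : (D : ℚ) ≠ 0 := by exact_mod_cast NeZero.ne D
  have : ((u.val : ℚ) / D) = (b : ℚ) / D + (t : ℤ) := by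
    have ht' : ((u.val : ℤ) : ℚ) - b = D * t := by exact_mod_cast ht
    push_cast at ht'
    field_simp
    linarith
  rw [this, ratPlusSymbol_add_intCast_holds]

/-- **Relocation of an odd-numerator `2`-power cusp to the Mazur–Tate indexing**: for `b` odd and `d = ±2^{n+2}`
there is `s mod 2ⁿ` with `[b/d]⁺_f = [5^s/2^{n+2}]⁺_f` (`5 = cyclotomicGenerator 2`; `±5^s` exhaust the odd residues
modulo `2^{n+2}` — the sibling seat's `exists_sign_mul_cyclotomicGenerator_pow_eq` —, `[−r]⁺ = [r]⁺`, `[r+1]⁺ = [r]⁺`).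
[cite: MazurTateTeitelbaum1986Invent, §I.13 (p = 2: Δ = {±1}, γ = 5)] -/
theorem exists_ratPlusSymbol_pow_cyclotomicGenerator_eq {b d : ℤ} (hb : Odd b) (n : ℕ)
    (hd : d.natAbs = 2 ^ (n + 2)) :
    ∃ s : ZMod (2 ^ n),
      ratPlusSymbol f ((((cyclotomicGenerator 2 : ZMod (2 ^ (n + 2))) ^ s.val).val : ℚ) / (2 : ℚ) ^ (n + 2)) =
        ratPlusSymbol f ((b : ℚ) / d) := by
  set D : ℕ := 2 ^ (n + 2) with hDdef
  haveI : NeZero D := ⟨pow_ne_zero _ two_ne_zero⟩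
  -- the odd natural representative `ℓ` of `b` modulo `D`
  set ℓ : ℕ := ((b : ZMod D)).val with hℓ
  have hℓb : ((ℓ : ℕ) : ZMod D) = (b : ZMod D) := by rw [hℓ, ZMod.natCast_zmod_val]
  have hℓodd : ¬ 2 ∣ ℓ := by
    intro h2
    have hD2 : (2 : ℤ) ∣ (D : ℤ) := by
      rw [hDdef]; push_cast; exact dvd_pow_self 2 (by omega)
    have hdiff : (D : ℤ) ∣ (ℓ : ℤ) - b := by
      rw [← ZMod.intCast_zmod_eq_zero_iff_dvd]; push_cast; rw [hℓb, sub_self]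
    have hb2 : (2 : ℤ) ∣ b := by
      have h1 : (2 : ℤ) ∣ (ℓ : ℤ) := by exact_mod_cast h2
      have := dvd_sub h1 (hD2.trans hdiff)
      simpa using this
    exact (Int.not_even_iff_odd.mpr hb) (even_iff_two_dvd.mpr hb2)
  obtain ⟨ω, hω, hℓeq⟩ := ThetaLayerLambdaCongruenceAtTwo.exists_sign_mul_cyclotomicGenerator_pow_eq hℓodd n
  set s : ZMod (2 ^ n) := PadicInt.toZModPow n (GreenbergVatsal2000.frobeniusExponent 2 (ℓ : ℤ_[2])) with hs
  refine ⟨s, ?_⟩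
  set u : ZMod D := (cyclotomicGenerator 2 : ZMod (2 ^ (n + 2))) ^ s.val with hudef
  have hDq : ((D : ℕ) : ℚ) = (2 : ℚ) ^ (n + 2) := by rw [hDdef]; push_cast; rfl
  -- `d = ± D`
  have hdD : d = D ∨ d = -(D : ℤ) := by
    rcases Int.natAbs_eq d with h | h
    · left; rw [h, hd]
    · right; rw [h, hd]
  -- `u = ω⁻¹ ℓ = ± b` in `ZMod D`
  rcases hω with rfl | rfl
  · rw [one_mul] at hℓeq
    have hu : u = (b : ZMod D) := by rw [← hℓeq, hℓb]
    rw [← hDq, ratPlusSymbol_val_div_eq_of_eq_intCast f hu]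
    rcases hdD with h | h
    · rw [h, Int.cast_natCast]
    · rw [h, Int.cast_neg, Int.cast_natCast, div_neg, ratPlusSymbol_neg]
  · have hu : u = ((-b : ℤ) : ZMod D) := by
      rw [Int.cast_neg, ← hℓb]
      linear_combination hℓeq
    rw [← hDq, ratPlusSymbol_val_div_eq_of_eq_intCast f hu]
    rcases hdD with h | h
    · rw [h, Int.cast_natCast, Int.cast_neg, neg_div, ratPlusSymbol_neg]
    · rw [h, Int.cast_neg, Int.cast_neg, Int.cast_natCast, neg_div, div_neg]

end Relocation

/-! ## §3. (G′)_N ⟹ FLAT -/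

section Flat

variable {N : ℕ} [NeZero N] (f : CuspForm (Gamma0 N) 2)

/-- For `γ ∈ SL(2, ℤ)` with EVEN lower-right entry, the upper-right entry is odd (`ad − bc = 1`). [folklore] -/
theorem odd_apply_zero_one_of_even (γ : SL(2, ℤ)) (hd : Even (γ 1 1)) : Odd (γ 0 1) := by
  have hdet := Matrix.det_fin_two γ.1
  rw [γ.2] at hdet
  by_contra hb
  rw [Int.not_odd_iff_even] at hb
  have h1 : Even (γ.1 0 0 * γ.1 1 1 - γ.1 0 1 * γ.1 1 0) :=
    Int.even_sub.mpr ⟨fun _ ↦ hb.mul_right _, fun _ ↦ hd.mul_left _⟩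
  rw [← hdet] at h1
  exact Int.not_even_one h1

/-- **(R) for one rational newform, Mazur–Tate indexing.** For a normalised newform `f ∈ S₂(Γ₀(N))` with rational
coefficients, ODD level and `a₂(f) = 0`: the dual spanning hypothesis (G′)_N (inline, as in
`exists_odd_re_cuspSymbol_of_cuspSpan`) implies that some plus symbol `[5^s/2^{n+2}]⁺_f` with `n` EVEN has `2`-adic
norm `≥ 2`. [cite: Pollack2003, Conj. 6.3] [cite: MazurTateTeitelbaum1986Invent, §I.8, §I.13] -/
theorem exists_two_le_norm_ratPlusSymbol_of_cuspSpan (hf : IsNewform0 f) (hQ : coeffField f = ⊥) (h2N : ¬ 2 ∣ N)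
    (ha₂ : cuspCoeff f 2 = 0)
    (hG : ∀ χ : Gamma0 N → ZMod 2,
      (∀ γ δ : Gamma0 N, χ (γ * δ) = χ γ + χ δ) →
      (∀ γ δ : Gamma0 N, periodFunctional N γ = periodFunctional N δ → χ γ = χ δ) →
      (∀ γ : Gamma0 N, (∃ k : ℕ, 1 ≤ k ∧ ((γ : SL(2, ℤ)) 1 1).natAbs = 4 ^ k) → χ γ = 0) →
      ∃ ψ : ZMod N → ZMod 2, (∀ x y : ZMod N, IsUnit x → IsUnit y → ψ (x * y) = ψ x + ψ y) ∧
        ∀ γ : Gamma0 N, χ γ = ψ ((((γ : SL(2, ℤ)) 1 1 : ℤ) : ZMod N))) :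
    ∃ n : ℕ, Even n ∧ ∃ s : ZMod (2 ^ n),
      2 ≤ ‖((ratPlusSymbol f ((((cyclotomicGenerator 2 : ZMod (2 ^ (n + 2))) ^ s.val).val : ℚ) /
        (2 : ℚ) ^ (n + 2)) : ℚ) : ℚ_[2])‖ := by
  have hΩ : plusPeriod f ≠ 0 := (IsNewform0.plusPeriod_pos_holds hf hQ).ne'
  have hT : heckeT (Gamma0 N) 2 2 f = ((0 : ℤ) : ℂ) • f := by
    rw [IsNewform0.heckeT_eq_coeff_smul hf Nat.prime_two]
    change cuspCoeff f 2 • f = _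
    rw [ha₂]; simp
  obtain ⟨γ, ⟨k, hk1, hk⟩, m, hmo, hm⟩ :=
    exists_odd_re_cuspSymbol_of_cuspSpan f hΩ Nat.prime_two h2N hT (by decide) hG
  -- `|d| = 4^k = 2^{(2k-2)+2}`
  have hd : ((γ : SL(2, ℤ)) 1 1).natAbs = 2 ^ ((2 * k - 2) + 2) := by
    rw [hk, show (4 : ℕ) = 2 ^ 2 by norm_num, ← pow_mul]
    congr 1; omega
  have hd0 : (γ : SL(2, ℤ)) 1 1 ≠ 0 := by
    intro h0
    rw [h0, Int.natAbs_zero] at hk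
    exact absurd hk.symm (pow_ne_zero k (by norm_num))
  have heven : Even ((γ : SL(2, ℤ)) 1 1) := by
    have h2 : (2 : ℤ) ∣ (γ : SL(2, ℤ)) 1 1 := by
      rw [← Int.natAbs_dvd_natAbs, hk]
      change 2 ∣ 4 ^ k
      exact dvd_pow (by norm_num) (by omega)
    exact even_iff_two_dvd.mpr h2
  have hb : Odd ((γ : SL(2, ℤ)) 0 1) := odd_apply_zero_one_of_even _ heven
  obtain ⟨s, hs⟩ := exists_ratPlusSymbol_pow_cyclotomicGenerator_eq f hb (2 * k - 2) hd
  refine ⟨2 * k - 2, ⟨k - 1, by omega⟩, s, ?_⟩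
  rw [hs, norm_ratPlusSymbol_eq_two_of_odd f hf hQ h2N ha₂ γ hd0 hmo hm]

variable {W : WeierstrassCurve ℚ} [W.IsElliptic] [W.IsGloballyMinimal]

/-- **THEOREM (R) on the habitat⁺: (G′)_{N_W} ⟹ FLAT at `(W, f)`.** For `W/ℚ` good supersingular at `2` with
`a₂(W) = 0` and its newform `f` (level `N_W`): if every additive `ZMod 2`-character of `Γ₀(N_W)` that factors through the
period homology and kills all `γ` with `|d(γ)| = 4^k`, `k ≥ 1`, factors through the lower-right entry — the dual form of
lead g4's (G′)_{N_W}, an `f`-free finite statement about `X₀(N_W)` — then `2 ∤ L♭` for EVERY Pollack pair `(L♯, L♭)`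
of `f` at `2` (μ(L♭_f) = 0). Chain: `…CuspSpanHeckeShimura` (Hecke–Shimura) → `…CuspSpanHecke` (odd doubled plus period
at a `4^k`-class, witness `T₂`) → §§1–2 (half-integral `[5^s/2^{n+2}]⁺_f`) → `flatAtTwo_of_two_le_norm_ratPlusSymbol`
(p578368 / FlatSymbols door). BSD is not proved by this; (G′)_{N_W} is a hypothesis. [cite: Pollack2003, Conj. 6.3 and Prop. 6.18] -/
theorem flatAtTwo_of_cuspSpan [NeZero (W.conductorNorm ℤ)] {f : CuspForm (Gamma0 (W.conductorNorm ℤ)) 2}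
    (hf : IsNewformOf W f) (hss : GoodSS W 2) (ha : W.frobeniusTrace 2 = 0)
    (hG : ∀ χ : Gamma0 (W.conductorNorm ℤ) → ZMod 2,
      (∀ γ δ : Gamma0 (W.conductorNorm ℤ), χ (γ * δ) = χ γ + χ δ) →
      (∀ γ δ : Gamma0 (W.conductorNorm ℤ),
        periodFunctional (W.conductorNorm ℤ) γ = periodFunctional (W.conductorNorm ℤ) δ → χ γ = χ δ) →
      (∀ γ : Gamma0 (W.conductorNorm ℤ), (∃ k : ℕ, 1 ≤ k ∧ ((γ : SL(2, ℤ)) 1 1).natAbs = 4 ^ k) → χ γ = 0) →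
      ∃ ψ : ZMod (W.conductorNorm ℤ) → ZMod 2,
        (∀ x y : ZMod (W.conductorNorm ℤ), IsUnit x → IsUnit y → ψ (x * y) = ψ x + ψ y) ∧
        ∀ γ : Gamma0 (W.conductorNorm ℤ), χ γ = ψ ((((γ : SL(2, ℤ)) 1 1 : ℤ) : ZMod (W.conductorNorm ℤ)))) :
    ∀ Lplus Lminus : IwasawaAlgebra 2, IsPollackPair f 2 Lplus Lminus → ¬ PowerSeries.C (2 : ℤ_[2]) ∣ Lminus := by
  have h2N : ¬ 2 ∣ W.conductorNorm ℤ := not_two_dvd_conductorNorm_of_goodSS hss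
  have ha₂ : cuspCoeff f 2 = 0 := by
    rw [hf.2 2, W.LFunction_apply_prime_eq_frobeniusTrace 2 hss.1, ha]; simp
  obtain ⟨n, hn, s, hs⟩ := exists_two_le_norm_ratPlusSymbol_of_cuspSpan f hf.1 hf.coeffField_eq_bot h2N ha₂ hG
  exact flatAtTwo_of_two_le_norm_ratPlusSymbol hn hs

/-- **(G′)_N for every odd `N` ⟹ the registered stub `FlatMuZeroAtTwo` of line `birth`** (spelled verbatim: on the
habitat⁺, `2 ∤ L♭` for every Pollack pair of the newform at `2`). The hypothesis is the dual spanning statement at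
every odd level (inline); nothing else. BSD is not proved by this. [cite: Pollack2003, Conj. 6.3 and Prop. 6.18] -/
theorem flatMuZeroAtTwo_of_cuspSpan
    (hG : ∀ (N : ℕ) [NeZero N], ¬ 2 ∣ N → ∀ χ : Gamma0 N → ZMod 2,
      (∀ γ δ : Gamma0 N, χ (γ * δ) = χ γ + χ δ) →
      (∀ γ δ : Gamma0 N, periodFunctional N γ = periodFunctional N δ → χ γ = χ δ) →
      (∀ γ : Gamma0 N, (∃ k : ℕ, 1 ≤ k ∧ ((γ : SL(2, ℤ)) 1 1).natAbs = 4 ^ k) → χ γ = 0) →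
      ∃ ψ : ZMod N → ZMod 2, (∀ x y : ZMod N, IsUnit x → IsUnit y → ψ (x * y) = ψ x + ψ y) ∧
        ∀ γ : Gamma0 N, χ γ = ψ ((((γ : SL(2, ℤ)) 1 1 : ℤ) : ZMod N))) :
    ∀ (W : WeierstrassCurve ℚ) [W.IsElliptic] [W.IsGloballyMinimal], ¬ W.HasCM → W.analyticRank = 0 →
      GoodSS W 2 → W.frobeniusTrace 2 = 0 → W.Δ < 0 →
      ∀ [NeZero (W.conductorNorm ℤ)] (f : CuspForm (Gamma0 (W.conductorNorm ℤ)) 2), IsNewformOf W f →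
      ∀ (Lplus Lminus : IwasawaAlgebra 2), IsPollackPair f 2 Lplus Lminus → ¬ PowerSeries.C (2 : ℤ_[2]) ∣ Lminus :=
  fun W _ _ _ _ hss ha _ _ _f hf ↦
    flatAtTwo_of_cuspSpan hf hss ha (hG (W.conductorNorm ℤ) (not_two_dvd_conductorNorm_of_goodSS hss))

/-- **(G′)_N for every odd `N` ∧ Abbes–Ullmo Thm A (by name) ⟹ the analytic child 21437 `SignedMuAnalyticAtTwoPlus`**
(through lead g0's `signedMuAnalyticAtTwoPlus_of_abbesUllmo_of_flatMuZero`, p569783). Conditional on the print fact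
`abbesUllmo_not_dvd_maninConstant_of_not_dvd_level` and on the hypothesis (G′); BSD is not proved by this.
[cite: AbbesUllmo1996, Thm. A] [cite: Pollack2003, Conj. 6.3 and Prop. 6.18] -/
theorem signedMuAnalyticAtTwoPlus_of_abbesUllmo_of_cuspSpan
    (hAU : abbesUllmo_not_dvd_maninConstant_of_not_dvd_level)
    (hG : ∀ (N : ℕ) [NeZero N], ¬ 2 ∣ N → ∀ χ : Gamma0 N → ZMod 2,
      (∀ γ δ : Gamma0 N, χ (γ * δ) = χ γ + χ δ) →
      (∀ γ δ : Gamma0 N, periodFunctional N γ = periodFunctional N δ → χ γ = χ δ) →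
      (∀ γ : Gamma0 N, (∃ k : ℕ, 1 ≤ k ∧ ((γ : SL(2, ℤ)) 1 1).natAbs = 4 ^ k) → χ γ = 0) →
      ∃ ψ : ZMod N → ZMod 2, (∀ x y : ZMod N, IsUnit x → IsUnit y → ψ (x * y) = ψ x + ψ y) ∧
        ∀ γ : Gamma0 N, χ γ = ψ ((((γ : SL(2, ℤ)) 1 1 : ℤ) : ZMod N))) :
    SignedMuAnalyticAtTwoPlus :=
  signedMuAnalyticAtTwoPlus_of_abbesUllmo_of_flatMuZero hAU (flatMuZeroAtTwo_of_cuspSpan hG)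

end Flat

end Summit.BirchSwinnertonDyer.BirchSwinnertonDyer.Theorems.SignedMuAtTwo

end
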